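import Literature.RepresentationTheory.MoeglinVignerasWaldspurger1987.RankOneThetaLift
import Literature.RepresentationTheory.MoeglinVignerasWaldspurger1987.RankOneThetaLiftNonvanishingProofs
import Literature.RepresentationTheory.MoeglinVignerasWaldspurger1987.RankOneThetaLiftAdmissibleProofs
import Literature.RepresentationTheory.TwistedCoinvariantsCompactIsotypic
import Literature.NumberTheory.GelbartRogawski1991.LocalSplittingConformallyIsometric
import Literature.NumberTheory.Automorphic.SchwartzBruhatL2Complement
import Literature.NumberTheory.Automorphic.UnitaryGroupLocalFactors
import Literature.NumberTheory.Automorphic.UnitaryGroupLocalCenterScalar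
import Literature.NumberTheory.Automorphic.UnitaryGroupDoubledBigCellNonsplit
import Literature.RepresentationTheory.HeisenbergGroup.LocalThetaDoublingDensity
import HarnessLib

/-!
# PROOF of [MVW 1987, Chap. 3 §IV.4 Théorème principal 1) a)] in the rank-one case at a non-split place:
# the theta lift of a character of the compact `U(1) = E_v¹` to `U(J)(F_v)` is IRREDUCIBLE OR ZERO
# (`mvw_IV4_rankOne_irreducibleOrZero_holds`)

Topic `RepresentationTheory/MoeglinVignerasWaldspurger1987`; namespace `Literature.RepresentationTheory.MoeglinVignerasWaldspurger1987`.
KERNEL ONLY: theorems; no definition, no named fact, no record, no `sorry`.  This file DISCHARGES the named fact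
`mvw_IV4_rankOne_irreducibleOrZero` of `RankOneThetaLift.lean` (tree convention `…_holds`).

[MoeglinVignerasWaldspurger1987, Chap. 3 §IV.4 Théorème principal 1) a)] «Si `π` est cuspidale, `ϑ_{m'}(π)` est irréductible
ou nulle»: for the dual pair `(U(W), U(V))` with `dim W = 1` at a NON-SPLIT finite place `v` (`E_v` a field), every character
`χ` of the compact `U(W)(F_v) = E_v¹` is cuspidal, and its big theta lift — the representation of `U(J)(F_v)` on the
`χ`-coinvariants of `ω_s` under the centre `E_v¹` — is irreducible or zero.  The printed proof goes through Kudla's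
filtration and Bernstein–Zelevinsky; the proof formalised here is HOWE's for a compact member of a dual pair
([Howe1979, §11], «doubling + density»):

* §1 `exists_orthogonal_pair` — a proper non-zero `ω_s`-invariant `W` inside the `χ`-isotypic subspace (which, `E_v¹` being
  compact, maps isomorphically onto the coinvariants: `TwistedCoinvariantsCompactIsotypic`) yields `f₁ ∈ W`, `f₂` in its
  `L²`-orthogonal complement, both `χ`-eigen and non-zero, with `⟨ω_s(g) f₁, f₂⟩ = 0` for all `g` — admissibility of `ω_s`
  at a non-split place (`isAdmissible_weil_localPi_of_isField`), conformal unitarity of every splitting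
  (`GelbartRogawski1991/LocalSplittingConformallyIsometric`), complements (`Automorphic/SchwartzBruhatL2Complement`);
* §2–§3 the engine `HeisenbergGroup.false_of_orthogonal_eigen_pair` (`HeisenbergGroup/LocalThetaDoublingDensity`): in the
  doubled space `V ⊕ V⁻` the Frobenius transform `φ = T_Δ(f₁ ⊠ conj f₂)` onto the `ℓ_Δ`-model is killed by the Gaussian
  functionals of the Cayley graphs of the generic elements `γ_c = (c−1)⁻¹(c+1) ∈ U(J)(F_v)`, `c` skew-hermitian
  (`Automorphic/UnitaryCayleyMomentMap`, `Automorphic/UnitaryGroupCayley`; local doubling identity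
  `HeisenbergGroup/DoubledDeltaDoublingIdentity` by uniqueness of `ℓ_Δ`-invariant functionals,
  `HeisenbergGroup/DoubledDeltaInvariantFunctional`, and the Cayley-graph algebra `HeisenbergGroup/DoubledDeltaCayleyGraph`);
  since the Cayley locus is the complement of a hypersurface (`LinearAlgebra/Matrix/DetLinearFamilyMvPolynomial`) the
  Fourier–Stieltjes transform of `φ dx` along the quadratic moment map `Q` vanishes identically
  (`Automorphic/LocalPiFourierStieltjesGenericVanishing`), the fibres of `Q` are `E_v¹`-orbits
  (`Semilinear/RankOneHermitianRigidityQuadratic`) along which `φ` is constant (`HeisenbergGroup/DoubledDeltaDiagonalInvariance`,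
  the centre acting by scalars `Automorphic/UnitaryGroupLocalCenterScalar`), so `φ = 0`
  (`Automorphic/LocallyConstantFibreVanishing`) — contradicting `f₁, f₂ ≠ 0`.

Written for the cell `hodgecm-mathlib` (fan B, rung B-IV, KEY `b4-howe-compact-irreducible`; row IV-1a of the citation
ledger of HC_CM).  Nothing of the cited sources is asserted; HC_CM is not mentioned further and is NOT proved by anything
here.

## References
* [MoeglinVignerasWaldspurger1987] C. Mœglin, M.-F. Vignéras, J.-L. Waldspurger, *Correspondances de Howe sur un corps
  p-adique*, LNM 1291 (1987), Chap. 3 §IV.4 Théorème principal 1) a); Chap. 2 II.1.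
* [Howe1979] R. Howe, *θ-series and invariant theory*, Proc. Symp. Pure Math. 33.1 (1979), §11.
* [Liu2021] Y. Liu, Camb. J. Math. 9 (2021), App. D Lemma D.1, p. 125.
-/

set_option autoImplicit false

noncomputable section

open NumberField IsDedekindDomain _root_.MeasureTheory
open scoped Matrix ComplexConjugate ENNReal
open Literature.RepresentationTheory Literature.RepresentationTheory.HeisenbergGroup
open Literature.NumberTheory.GelbartRogawski1991.UnitaryDualPair.LocalSplitting
open Literature.NumberTheory.Automorphic Literature.NumberTheory.Automorphic.UnitaryGroup
open Literature.NumberTheory.Automorphic.Liu2021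

namespace Literature.RepresentationTheory.MoeglinVignerasWaldspurger1987

/-! ## §1 An orthogonal pair from a proper invariant subspace (E1) -/

set_option maxHeartbeats 400000 in
/-- **E1.** If `W` is a proper non-zero `ω_s`-invariant subspace of a `U(J)(F_v)`-invariant subspace `V₀ ≤ 𝒮(F_vᴺ)`, there
are `f₁ ∈ W`, `f₂ ∈ V₀`, both non-zero, with `∫ conj(ω_s(g) f₁) · f₂ = 0` for all `g` — admissibility of `ω_s` at a
non-split place (`isAdmissible_weil_localPi_of_isField`), conformal unitarity of every splitting
(`LocalSplittingConformallyIsometric`) and `L²`-orthogonal complements (`SchwartzBruhatL2Complement`).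
[cite: MoeglinVignerasWaldspurger1987, Chap. 3 §IV.4 Théorème principal 1) a)] -/
theorem exists_orthogonal_pair (F : Type) [Field F] [NumberField F] (E : Type) [Field E] [NumberField E]
    [Algebra F E] [Algebra.IsQuadraticExtension F E] (c : E ≃ₐ[F] E) (N : ℕ) (δ : E) (hcδ : c δ = -δ) (hδ : δ ≠ 0) (d : F)
    (hd : δ * δ = algebraMap F E d) (T : Matrix (Fin N) (Fin N) F) (hT : T.IsSymm) (hTd : IsUnit T.det)
    (J : Matrix (Fin N) (Fin N) E) (hJ : J = T.map (algebraMap F E)) (v : HeightOneSpectrum (𝓞 F))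
    (hE : IsField (UnitaryGroup.LocalRing E v))
    (s : UnitaryGroup.localPi E c N J v →* LocalMp F N T v)
    (hs : ∀ g, MpPsi.proj _ (s g) = iota F E c N hcδ hδ hd T hT hJ v g)
    (hsm : Representation.IsSmooth ((MpPsi.toRep (localSchrodinger F N T v)).comp s))
    [MeasurableSpace (v.adicCompletion F)] [BorelSpace (v.adicCompletion F)]
    (μ' : Measure (v.adicCompletion F)) [μ'.IsAddHaarMeasure]
    (V₀ W : Submodule ℂ (SchwartzBruhat (Fin N → v.adicCompletion F)))
    (hWst : ∀ g, W.map (((MpPsi.toRep (localSchrodinger F N T v)).comp s) g) ≤ W)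
    (hWV : W ≤ V₀) (hW0 : W ≠ ⊥) (hWV' : W ≠ V₀) :
    ∃ f₁ ∈ W, ∃ f₂ ∈ V₀, f₁ ≠ 0 ∧ f₂ ≠ 0 ∧ ∀ g : UnitaryGroup.localPi E c N J v,
      ∫ x, conj (((((MpPsi.toRep (localSchrodinger F N T v)).comp s) g f₁ : SchwartzBruhat (Fin N → v.adicCompletion F)) :
          (Fin N → v.adicCompletion F) → ℂ) x) *
        ((f₂ : SchwartzBruhat (Fin N → v.adicCompletion F)) : (Fin N → v.adicCompletion F) → ℂ) x
        ∂(Measure.pi fun _ : Fin N => μ') = 0 := by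
  haveI := secondCountableTopology_adicCompletion F v
  set ω : Representation ℂ (localPi E c N J v) (SchwartzBruhat (Fin N → v.adicCompletion F)) :=
    (MpPsi.toRep (localSchrodinger F N T v)).comp s with hω
  set ν : Measure (Fin N → v.adicCompletion F) := Measure.pi fun _ : Fin N => μ' with hν
  have hadm : ω.IsAdmissible := isAdmissible_weil_localPi_of_isField F E c N δ hcδ hδ d hd T hT hTd J hJ v hE s hs hsm
  have hconf : ∀ g : localPi E c N J v, ∃ c : ℝ≥0∞, c ≠ 0 ∧ c ≠ ∞ ∧ ∀ Φ,
      SchwartzBruhat.l2NormSq ν (ω g Φ) = c * SchwartzBruhat.l2NormSq ν Φ := fun g =>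
    exists_l2NormSq_toRep_comp_eq_mul (hTd := hTd) μ' s g
  let K₀ : OpenSubgroup (localPi E c N J v) := ⟨localInt E c N J v, isOpen_localInt E c N J v⟩
  have hK₀ : IsCompact ((K₀ : Set (localPi E c N J v))) := isCompact_localInt E c N J v
  have hKiso : ∀ k ∈ K₀, ∀ Φ, SchwartzBruhat.l2NormSq ν (ω k Φ) = SchwartzBruhat.l2NormSq ν Φ := fun k hk Φ =>
    l2NormSq_toRep_comp_eq_of_mem_compact (hTd := hTd) μ' s hsm (localInt E c N J v) (isCompact_localInt E c N J v) hk Φ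
  have hWinv : ∀ g, ∀ u ∈ W, ω g u ∈ W := fun g u hu => hWst g ⟨u, hu, rfl⟩
  obtain ⟨U', hU'mem, hU'inv, hinf, hsup⟩ :=
    SchwartzBruhat.exists_orthogonal_compl_of_isAdmissible ν K₀ hK₀ hadm hconf hKiso W hWinv
  -- `V₀ = W ⊔ (V₀ ⊓ U')` (modular law), so `V₀ ⊓ U' ≠ ⊥`
  have hmod : W ⊔ (V₀ ⊓ U') = V₀ := by
    rw [inf_comm, ← sup_inf_assoc_of_le U' hWV, hsup, top_inf_eq]
  have hne : V₀ ⊓ U' ≠ ⊥ := by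
    intro h0
    rw [h0, sup_bot_eq] at hmod
    exact hWV' hmod
  obtain ⟨f₂, hf₂, hf₂0⟩ := (Submodule.ne_bot_iff _).1 hne
  obtain ⟨f₁, hf₁, hf₁0⟩ := (Submodule.ne_bot_iff _).1 hW0
  refine ⟨f₁, hf₁, f₂, (Submodule.mem_inf.1 hf₂).1, hf₁0, hf₂0, fun g => ?_⟩
  exact (hU'mem f₂).1 (Submodule.mem_inf.1 hf₂).2 _ (hWinv g f₁ hf₁)

/-! ## §2 The engine, restated for a model EQUAL to the Gram Schrödinger model (so that the tree's `localSchrodinger`,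
a `def`, can be fed in through `rfl` without definitional unfolding inside a large application) -/

section EngineVariant

open Literature.NumberTheory.Automorphic.UnitaryGroup.QuadraticCoordinates

/-- `HeisenbergGroup.false_of_orthogonal_eigen_pair` for any `ρ₁ = schrodingerSB ⟨·, T₀ ·⟩ ψ`. [cite: Howe1979, §11] -/
theorem false_of_orthogonal_eigen_pair_of_eq
    {F : Type*} [Field F] [ValuativeRel F] [TopologicalSpace F] [IsNonarchimedeanLocalField F] [Invertible (2 : F)]
    [T2Space F] {K : Type*} [Field K] [Algebra F K] [Module.Finite F K] {Ψ : (F × F) ≃+ K} {δ : K} {d : F}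
    (hq : IsQuadraticCoordinates (algebraMap F K) Ψ δ d) {σ : K →+* K}
    (hσφ : ∀ a, σ (algebraMap F K a) = algebraMap F K a) (hσδ : σ δ = -δ) (hσσ : ∀ x, σ (σ x) = x)
    {n : Type*} [Fintype n] [DecidableEq n] {T₀ : Matrix n n F} (hT₀s : T₀.IsSymm) (hT₀d : IsUnit T₀.det)
    {H : Matrix n n K} (hH : H = T₀.map (algebraMap F K))
    {ι : Type*} [Fintype ι] [DecidableEq ι] (e : n ⊕ n ≃ ι) {T : Matrix ι ι F}
    (hT : T = Matrix.reindex e e (Matrix.fromBlocks T₀ 0 0 (-T₀)))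
    {ψ : AddChar F Circle} (hl : IsLocallyConstant (⇑ψ : F → Circle)) (hψ : ψ.IsContinuousNontrivial)
    (hb₀ : ∀ y : n → F, Continuous fun u : n → F => Matrix.toLinearMap₂' F T₀ u y)
    (hb₀' : ∀ y : n → F, Continuous fun u : n → F => Matrix.toLinearMap₂' F (-T₀) u y)
    (hb : ∀ y : ι → F, Continuous fun u : ι → F => Matrix.toLinearMap₂' F T u y)
    (hbΔ : ∀ y : ι → F, Continuous fun u : ι → F => Matrix.toLinearMap₂' F (deltaGram e T₀) u y)
    [MeasurableSpace (n → F)] [BorelSpace (n → F)] (μ : Measure (n → F)) [μ.IsAddHaarMeasure]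
    [MeasurableSpace (ι → F)] [BorelSpace (ι → F)] (ν : Measure (ι → F)) [ν.IsAddHaarMeasure] [SFinite ν]
    (ρ₁ : Representation ℂ (Heisenberg (polar (Matrix.toLinearMap₂' F T₀))) (SchwartzBruhat (n → F)))
    (hρ₁ : ρ₁ = schrodingerSB (Matrix.toLinearMap₂' F T₀) ψ hl hb₀)
    {G : Type*} [Group G] (sG : G →* MpPsi ρ₁)
    (h2 : (2 : F) ≠ 0) (f₁ f₂ : SchwartzBruhat (n → F)) (hf₁ : f₁ ≠ 0) (hf₂ : f₂ ≠ 0)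
    (horth : ∀ g : G, ∫ u, conj (((MpPsi.toRep _ (sG g) f₁ : SchwartzBruhat (n → F)) : (n → F) → ℂ) u) *
      ((f₂ : SchwartzBruhat (n → F)) : (n → F) → ℂ) u ∂μ = 0)
    (hsupply : ∀ t : n × n × Fin 2 → F, IsUnit (skewFamily Ψ σ H t - 1).det → IsUnit (skewFamily Ψ σ H t + 1).det →
      ∃ g : G, ∀ w, ((MpPsi.proj _ (sG g)).1 : _ ≃ₗ[F] _) w = hq.resEnd n (cayleyFamily Ψ σ H t) w)
    (hcenter : ∀ l : K, l * σ l = 1 → ∃ g : G, ∃ ξ : ℂ, ‖ξ‖ = 1 ∧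
      (∀ y : n → K, ((MpPsi.proj _ (sG g)).1 : _ ≃ₗ[F] _) (reIm Ψ n y) = reIm Ψ n (l • y)) ∧
      MpPsi.toRep _ (sG g) f₁ = ξ • f₁ ∧ MpPsi.toRep _ (sG g) f₂ = ξ • f₂)
    (𝒯 : SchwartzBruhat (ι → F) ≃ₗ[ℂ] SchwartzBruhat (ι → F))
    (h𝒯 : ∀ Φ : SchwartzBruhat (ι → F), ((𝒯 Φ : SchwartzBruhat (ι → F)) : (ι → F) → ℂ) =
      frobeniusToSchrodinger ((schrodingerSB (Matrix.toLinearMap₂' F T) ψ hl hb).comp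
        (deltaHeisenbergEquiv e T₀ hT).symm.toMonoidHom : Representation ℂ _ (SchwartzBruhat (ι → F)))
        (diagIntegral e μ) Φ) : False := by
  subst hρ₁
  exact false_of_orthogonal_eigen_pair hq hσφ hσδ hσσ hT₀s hT₀d hH e hT hl hψ hb₀ hb₀' hb hbΔ μ ν sG h2 f₁ f₂ hf₁ hf₂ horth
    hsupply hcenter 𝒯 h𝒯

end EngineVariant

/-! ## §3 The theorem -/

open QuadraticCoordinates in
set_option maxHeartbeats 1600000 in -- the 30-binder statement and the engine application need it
/-- **[MVW 1987, Chap. 3 §IV.4 Théorème principal 1) a)], rank-one case, non-split place — PROVED**: for every splitting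
`s` of `U(J)(F_v)` into `S̃p_{ψ_v}(𝕎_v)` over `ι_v` with `ω_s` smooth, every hermitian line `J₁` and every unitary
continuous character `χ` of `U(J₁)(F_v) = E_v¹`, the representation of `U(J)(F_v)` on the `χ`-coinvariants of `ω_s` under
the centre is IRREDUCIBLE OR ZERO.  Proof: Howe's «doubling + density» ([Howe1979, §11]) — the tree's engine
`HeisenbergGroup.false_of_orthogonal_eigen_pair` fed with the orthogonal pair of §1, the Cayley elements of `U(J)(F_v)`
(`UnitaryCayleyMomentMap`) and the centre (`UnitaryGroupLocalCenterScalar`).  Discharges the named fact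
`mvw_IV4_rankOne_irreducibleOrZero`. [cite: MoeglinVignerasWaldspurger1987, Chap. 3 §IV.4 Théorème principal 1) a)] -/
theorem mvw_IV4_rankOne_irreducibleOrZero_holds : mvw_IV4_rankOne_irreducibleOrZero := by
  intro F _ _ E _ _ _ _ c N δ hcδ hδ d hd T hT hTd J hJ v hE s hs hsm J₁ hJ₁ χ hχu hχc
  /- §0 the non-split place: compact torus, smooth action, open kernel -/
  have hc1 : c ≠ 1 := by
    rintro rfl
    exact hδ (self_eq_neg.1 (by simpa only [AlgEquiv.one_apply] using hcδ))
  obtain ⟨w⟩ := (inferInstance : Nonempty (PlacesOver E v))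
  have hw : c • w.1 = w.1 := by
    by_contra hw
    exact LemD1IndexedNonVacuityAtPlace.not_isField_localRing_of_split E v c w hw hE
  haveI hsub : Subsingleton (PlacesOver E v) := PlacesOver.subsingleton_of_smul_eq c hc1 w hw
  haveI : CompactSpace (localPi E c 1 J₁ v) := compactSpace_localPi_one_of_smul_eq c J₁ hc1 hJ₁ w hw
  let ω : Representation ℂ (localPi E c N J v) (SchwartzBruhat (Fin N → v.adicCompletion F)) :=
    (MpPsi.toRep (localSchrodinger F N T v)).comp s
  let M : Representation ℂ (localPi E c 1 J₁ v) (SchwartzBruhat (Fin N → v.adicCompletion F)) :=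
    ω.comp (localCenter E c N J J₁ hJ₁ v)
  have hMs : M.IsSmooth := fun Φ =>
    show IsOpen ((localCenter E c N J J₁ hJ₁ v) ⁻¹'
      ((Representation.stabilizerSubgroup ω Φ : Subgroup (localPi E c N J v)) : Set (localPi E c N J v))) from
      (hsm Φ).preimage (continuous_localCenter E c N J J₁ hJ₁ v)
  have hχo : IsOpen (χ.ker : Set (localPi E c 1 J₁ v)) := isOpen_ker_of_smul_eq c J₁ hc1 hJ₁ w hw χ hχc
  have hcomm : ∀ (g : localPi E c N J v) (z : localPi E c 1 J₁ v), Commute (ω g) (M z) := fun g z =>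
    (show Commute g (localCenter E c N J J₁ hJ₁ v z) from localCenter_comm E c N J J₁ hJ₁ v z g).map ω
  /- E0: reduce to the `χ`-isotypic subspace -/
  refine (TwistedCoinv.isIrreducibleOrZero_rep_iff M χ ω hcomm hMs hχo).2 fun W hWE hWst => ?_
  by_contra hne
  push Not at hne
  obtain ⟨hW0, hWE'⟩ := hne
  /- E1: the orthogonal pair -/
  letI : MeasurableSpace (v.adicCompletion F) := borel _
  haveI : BorelSpace (v.adicCompletion F) := ⟨rfl⟩
  haveI := secondCountableTopology_adicCompletion F v
  have hEinv : ∀ g : localPi E c N J v,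
      (weightSpace M id (fun h => ((χ h : ℂˣ) : ℂ))).map (ω g) ≤ weightSpace M id (fun h => ((χ h : ℂˣ) : ℂ)) :=
    fun g => TwistedCoinv.map_weightSpace_le M χ (ω g) (fun h => hcomm g h)
  obtain ⟨f₁, hf₁W, f₂, hf₂E, hf₁0, hf₂0, horth⟩ := exists_orthogonal_pair F E c N δ hcδ hδ d hd T hT hTd J hJ v hE s hs hsm
    Measure.addHaar _ W hWst hWE hW0 hWE'
  /- the local data for the engine -/
  haveI hchar : CharZero (v.adicCompletion F) := charZero_of_injective_algebraMap (algebraMap F (v.adicCompletion F)).injective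
  letI : Field (LocalRing E v) := hE.toField
  haveI : Module.Finite (v.adicCompletion F) (LocalRing E v) := finite_localRing E v c hcδ hδ
  have hq := isQuadraticCoordinates_local E v c hcδ hδ hd
  have hσφ : ∀ a, conjLocal E c v (algebraMap (v.adicCompletion F) (LocalRing E v) a) =
      algebraMap (v.adicCompletion F) (LocalRing E v) a := conjLocal_toLocalRing c v
  have hσδ : conjLocal E c v (algebraMap E (LocalRing E v) δ) = -algebraMap E (LocalRing E v) δ := by
    rw [conjLocal_algebraMap, hcδ, map_neg]
  have hσσ : ∀ x, conjLocal E c v (conjLocal E c v x) = x := conjLocal_conjLocal c v hcδ hδ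
  have hT₀s : (localGram F N T v).IsSymm := hT.map _
  have hT₀d : IsUnit (localGram F N T v).det := isUnit_det_map _ hTd
  have hH : (adelicForm E N J).map (adeleToLocal E v) =
      (localGram F N T v).map (algebraMap (v.adicCompletion F) (LocalRing E v)) := localForm_eq_map E N v T hJ
  have hψ := isContinuousNontrivial_adeleAddCharAt F v
  have hl : IsLocallyConstant (⇑(adeleAddCharAt F v) : v.adicCompletion F → Circle) :=
    isLocallyConstant_of_isContinuousNontrivial hψ
  have hcont : ∀ {m : Type} [Fintype m] [DecidableEq m] (A : Matrix m m (v.adicCompletion F)) (y : m → v.adicCompletion F),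
      Continuous fun u : m → v.adicCompletion F => Matrix.toLinearMap₂' (v.adicCompletion F) A u y := by
    intro m _ _ A y
    simp only [Matrix.toLinearMap₂'_apply']
    exact continuous_id.dotProduct continuous_const
  set e : Fin N ⊕ Fin N ≃ Fin (N + N) := finSumFinEquiv with he
  have hTD : Matrix.reindex e e (Matrix.fromBlocks (localGram F N T v) 0 0 (-localGram F N T v)) =
      Matrix.reindex e e (Matrix.fromBlocks (localGram F N T v) 0 0 (-localGram F N T v)) := rfl
  set μ : Measure (Fin N → v.adicCompletion F) := Measure.pi fun _ : Fin N => Measure.addHaar with hμ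
  obtain ⟨𝒯, h𝒯⟩ := exists_deltaFrobeniusEquiv e (localGram F N T v) hTD hl (hcont _) μ hψ hT₀d
  have h2 : (2 : v.adicCompletion F) ≠ 0 := two_ne_zero
  have hρ : localSchrodinger F N T v =
      schrodingerSB (Matrix.toLinearMap₂' (v.adicCompletion F) (localGram F N T v)) (adeleAddCharAt F v) hl (hcont _) := rfl
  refine false_of_orthogonal_eigen_pair_of_eq (K := LocalRing E v) (n := Fin N) (ι := Fin (N + N))
    (σ := conjLocal E c v) (T₀ := localGram F N T v) (H := (adelicForm E N J).map (adeleToLocal E v))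
    (T := Matrix.reindex e e (Matrix.fromBlocks (localGram F N T v) 0 0 (-localGram F N T v))) (ψ := adeleAddCharAt F v)
    (G := ↥(localPi E c N J v)) hq hσφ hσδ hσσ hT₀s hT₀d hH e hTD hl hψ (hcont _) (hcont _) (hcont _)
    (hcont _) μ (Measure.addHaar : Measure (Fin (N + N) → v.adicCompletion F)) (localSchrodinger F N T v) hρ s h2 f₁ f₂
    hf₁0 hf₂0 horth ?_ ?_ 𝒯 h𝒯
  · /- (supply) the Cayley elements of `U(J)(F_v)` -/
    intro t hm hp
    have hγ := isUnit_cayleyFamily (Ψ := (quadraticLocalEquiv E v c hcδ hδ).toLinearEquiv.toAddEquiv)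
      (σ := conjLocal E c v) (H := (adelicForm E N J).map (adeleToLocal E v)) t hm hp
    have hmem : (hγ.unit : GL (Fin N) (LocalRing E v)) ∈ «local» E c N J v := by
      show _ ∈ unitaryGroupOfForm _ _
      rw [mem_unitaryGroupOfForm_iff, IsUnit.unit_spec]
      exact cayleyFamily_transpose_mul_mul hσφ hσσ hT₀s hT₀d hH t hm hp
    refine ⟨(localPiEquiv E c N J v).symm ⟨_, hmem⟩, fun x => ?_⟩
    rw [hs, iota_def]
    show ((localToSymplectic E c N v hcδ hδ hd hT hJ
      (localPiEquiv E c N J v ((localPiEquiv E c N J v).symm ⟨_, hmem⟩))).1 : _ ≃ₗ[v.adicCompletion F] _) x = _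
    rw [ContinuousMulEquiv.apply_symm_apply]
    show hq.resAut (Fin N) (hγ.unit : GL (Fin N) (LocalRing E v)) x = _
    rw [hq.resAut_apply, IsUnit.unit_spec]
  · /- (centre) the centre `E_v¹` acts by the scalar and by `χ` on `f₁, f₂` -/
    intro l hl1
    have hl0 : l ≠ 0 := by
      rintro rfl
      rw [zero_mul] at hl1
      exact zero_ne_one hl1
    set z : (LocalRing E v)ˣ := Units.mk0 l hl0 with hz
    have hzz : (z : LocalRing E v) * conjLocal E c v z = 1 := hl1
    refine ⟨localCenter E c N J J₁ hJ₁ v (localUnitScalar E c J₁ v z hzz), ((χ (localUnitScalar E c J₁ v z hzz) : ℂˣ) : ℂ),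
      hχu _, fun y => ?_, ?_, ?_⟩
    · rw [hs]
      exact iota_localCenter_localUnitScalar_reIm E c N J J₁ v hcδ hδ hd T hT hJ hJ₁ z hzz y
    · exact (mem_weightSpace.1 (hWE hf₁W)) (localUnitScalar E c J₁ v z hzz)
    · exact (mem_weightSpace.1 hf₂E) (localUnitScalar E c J₁ v z hzz)

end Literature.RepresentationTheory.MoeglinVignerasWaldspurger1987

end
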